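import Summits.AtomisticToContinuum.FouriersLaw.Theorems.BondHeatUncertaintyBoundedResponseBathHeatHorizonReturnB
import HarnessLib

/-!
# BondHeatUncertainty / BoundedResponse — «HorizonReturn» §4–§5: the HORIZON SPLIT of the late functional, the pointwise DOOR, the graded pieces
`(HZᶠ_{q,g})` / `(HM_{a,q,δ})`, the FREE RUNG and ★★★ THE DOOR to `LateTailFloor a 1 1` and to 11071 (part 3 of 5 — overview in the main file `…BathHeatHorizonReturn`)

§4 ★ `bathTailLate_eq_horizon`: `B^late_N(s,t) = γ²∫θ₀·U^{s,t;τ}_N dμ_T + γ²·t·Rem_N(τ)` (`τ ≥ max(t,2s)`); ★ `bathTailLate_ge_horizon`: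
`B^late_N(s,t) ≥ −γ²𝔇_T(𝔊^{s,t;τ}_N) + γ²·t·Rem_N(τ)`; `horizonReturnProfile_sq_le` (free budget of the curve).
§5 the route Props `HorizonRemainderFloor (q : ℕ) (g : ℝ)`, `HorizonReturnMonotoneOn (a : ℝ) (q : ℕ) (δ : ℝ)` (ROUTE STATEMENTS of this cell, tagged in
their docstrings — UNDECIDED · INSTRUMENTABLE · IDEA-NEEDED · phonon-TRUE; not literature facts); `HorizonRemainderFloor.mono`; `∫_{(0,∞)}K_N ≥ 0`
(from `escapeDeficit ≤ 1`); `Rem_N(τ) ≥ −2T²τ`; ★ the FREE RUNG `horizonRemainderFloor_free : HorizonRemainderFloor q (q+2)`; the pure-real packaging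
`thermalCrossDefect_le_of_confined`; ★★★ `lateTailFloor_one_of_horizon : 0 ≤ a → 3 ≤ q → 0 < δ → HorizonRemainderFloor q 1 → HorizonReturnMonotoneOn a q δ →
LateTailFloor a 1 1` and `boundedResponse_of_subdiffusiveBondHeat_horizon` (with (S), the blocker 11071). No `sorry`, no new axioms.
-/

noncomputable section

open MeasureTheory ProbabilityTheory Filter Topology Set Function
open scoped NNReal ENNReal
open Literature.MathematicalPhysics.KineticTheory.HeatConduction
open Literature.MathematicalPhysics.KineticTheory OscillatorChain
open Literature.Probability.Process
open Summit.AtomisticToContinuum.FouriersLaw.Theorems.OddSectorIrreversibility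
  (pinnedChain_stronglyMeasurable_act_uncurry pinnedChain_integral_sq_act_le_of_stronglyMeasurable
    pinnedChain_integrable_transitionKernel_of_abs_le integral_exp_neg_mul_Ioi' integrable_mul_of_integrable_sq)
open Summit.AtomisticToContinuum.FouriersLaw.Theorems.BoundedResponse.ParityFloor
  (kinObs kinAct continuous_kinObs abs_kinObs_le stronglyMeasurable_kinAct abs_kinAct_le kinAct_integrableOn
    harrisBound_exists weight_facts kinObs_sq_facts)

namespace Summit.AtomisticToContinuum.FouriersLaw.Theorems.BoundedResponse.HeatSpreading

/-! ## §4 ★ The HORIZON SPLIT of the late functional and the pointwise DOOR -/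

section HorizonSplit

variable {ω₂ lam β γ : ℝ} {T : ℝ} (hω : 0 < ω₂) (hl : 0 < lam) (hβ : 0 < β) (hγ : 0 < γ) (hT : 0 < T)
include hω hl hβ hγ hT

/-- ★ **THE HORIZON SPLIT + MICROSTATE REPRESENTATION** (`N = n+1`, `0 ≤ s`, `0 ≤ t ≤ τ`, `2s ≤ τ`):
`B^late_N(s,t) = γ²·∫ θ₀·U^{s,t;τ}_N dμ_T + γ²·t·Rem_N(τ)` — past the horizon the late weight is the constant `t`. [this cell] -/
theorem bathTailLate_eq_horizon (n : ℕ) {s t τ : ℝ} (hs : 0 ≤ s) (ht : 0 ≤ t) (htτ : t ≤ τ) (hsτ : 2 * s ≤ τ) :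
    bathTailLate ω₂ lam β γ T (n + 1) s t =
      γ ^ 2 * ∫ z : PhaseSpace (n + 1), (z.2 0 ^ 2 - T) * horizonCumFcast ω₂ lam β γ T (n + 1) s t τ z
          ∂((pinnedChain ω₂ lam β γ).gibbsMeasure (n + 1) T) +
        γ ^ 2 * t * bathKinRem ω₂ lam β γ T (n + 1) τ := by
  have hτ0 : 0 ≤ τ := by linarith
  rw [bathTailLate_eq_integral hω hl hβ hγ hT (Nat.succ_pos n) hs ht]
  have hIK := integrableOn_lateWeight_mul_bathKinCorr hω hl hβ hγ hT (Nat.succ_pos n) hs ht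
  -- split `(0,∞) = (0,τ] ∪ (τ,∞)`
  have hsplit : ∫ r in Ioi (0:ℝ), lateWeight s t r * bathKinCorr ω₂ lam β γ T (n + 1) r =
      (∫ r in Ioc (0:ℝ) τ, lateWeight s t r * bathKinCorr ω₂ lam β γ T (n + 1) r) +
        ∫ r in Ioi τ, lateWeight s t r * bathKinCorr ω₂ lam β γ T (n + 1) r := by
    rw [← setIntegral_union (Set.Ioc_disjoint_Ioi le_rfl) measurableSet_Ioi (hIK.mono_set Ioc_subset_Ioi_self)
      (hIK.mono_set (Ioi_subset_Ioi hτ0)), Ioc_union_Ioi_eq_Ioi hτ0]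
  -- past the horizon `ℓ ≡ t`
  have htail : ∫ r in Ioi τ, lateWeight s t r * bathKinCorr ω₂ lam β γ T (n + 1) r = t * bathKinRem ω₂ lam β γ T (n + 1) τ := by
    unfold bathKinRem
    rw [← integral_const_mul]
    refine setIntegral_congr_fun measurableSet_Ioi fun r hr => ?_
    have hr' : τ < r := hr
    rw [lateWeight_eq_min hs (by linarith), min_eq_right (by linarith)]
  -- before the horizon: weighted Fubini with `w = 𝟙_{(−∞,τ]}·ℓ`
  have hfin : ∫ r in Ioc (0:ℝ) τ, lateWeight s t r * bathKinCorr ω₂ lam β γ T (n + 1) r =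
      ∫ z : PhaseSpace (n + 1), (z.2 0 ^ 2 - T) * horizonCumFcast ω₂ lam β γ T (n + 1) s t τ z
        ∂((pinnedChain ω₂ lam β γ).gibbsMeasure (n + 1) T) := by
    obtain ⟨hϑ0, h2ϑ, hϑ1⟩ := weight_facts hT
    obtain ⟨K, c, hK0, hc, hb⟩ := harrisBound_exists hω hl.le hβ hγ (Nat.succ_pos n) hT hϑ0 hϑ1
    haveI := pinnedChain_isProbabilityMeasure_gibbsMeasure hω hl.le hβ.le γ (n + 1) hT
    have hν := pinnedChain_integrable_exp_mul_hamiltonian_gibbsMeasure hω hl.le hβ.le γ (n + 1) hT h2ϑ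
    obtain ⟨hθm, hθ2⟩ := kinObs_sq_facts hω hl.le hβ hγ (Nat.succ_pos n) hT (0 : Fin (n + 1))
    have hwm : Measurable ((Iic τ).indicator (lateWeight s t)) := (continuous_lateWeight s t).measurable.indicator measurableSet_Iic
    have hwb : ∀ u : ℝ, 0 < u → |(Iic τ).indicator (lateWeight s t) u| ≤ |t| + 4 * |s| := by
      intro u hu
      by_cases hu' : u ∈ Iic τ
      · rw [indicator_of_mem hu']; exact abs_lateWeight_le s t hu.le
      · rw [indicator_of_notMem hu', abs_zero]; positivity
    have h := integral_mul_setIntegral_weight_kinAct hω hl.le hβ.le hγ.le hT hϑ0 hK0.le hb hc 0 _ hν hθm hθ2 hwm hwb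
    -- left side: `∫_{(0,τ]} ℓ K = ∫_{(0,∞)} w(u) ∫ θ₀ v_u dμ du`
    have e1 : ∫ r in Ioc (0:ℝ) τ, lateWeight s t r * bathKinCorr ω₂ lam β γ T (n + 1) r =
        ∫ u in Ioi (0:ℝ), (Iic τ).indicator (lateWeight s t) u *
          ∫ z, kinObs T (n + 1) 0 z * kinAct ω₂ lam β γ T (n + 1) 0 u z ∂((pinnedChain ω₂ lam β γ).gibbsMeasure (n + 1) T) := by
      rw [setIntegral_Ioc_eq_Ioi_indicator]
      refine setIntegral_congr_fun measurableSet_Ioi fun u _ => ?_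
      rw [Set.indicator_mul_left, bathKinCorr_succ_eq_integral_kinObs_mul_kinAct]
    -- right side: the inner weighted time integral is `U^{s,t;τ}`
    have e2 : ∀ z : PhaseSpace (n + 1), ∫ u in Ioi (0:ℝ), (Iic τ).indicator (lateWeight s t) u * kinAct ω₂ lam β γ T (n + 1) 0 u z =
        horizonCumFcast ω₂ lam β γ T (n + 1) s t τ z := by
      intro z
      rw [horizonCumFcast_succ, setIntegral_Ioc_eq_Ioi_indicator]
      refine setIntegral_congr_fun measurableSet_Ioi fun u _ => ?_
      rw [Set.indicator_mul_left]
    rw [e1, ← h]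
    refine integral_congr_ae (ae_of_all _ fun z => ?_)
    beta_reduce
    rw [e2]
    rfl
  rw [hsplit, htail, hfin]
  ring

/-- ★★ **THE HORIZON HEAT-RETURN DOOR, pointwise**: `B^late_N(s,t) ≥ −γ²·𝔇_T(𝔊^{s,t;τ}_N) + γ²·t·Rem_N(τ)` (`N = n+1`, `0 ≤ s`, `0 ≤ t ≤ τ`,
`2s ≤ τ`) — the late functional is floored by the crossing defect of the FINITE-HORIZON return curve plus the horizon remainder. [this cell] -/
theorem bathTailLate_ge_horizon (n : ℕ) {s t τ : ℝ} (hs : 0 ≤ s) (ht : 0 ≤ t) (htτ : t ≤ τ) (hsτ : 2 * s ≤ τ) :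
    -(γ ^ 2 * thermalCrossDefect T (horizonReturnProfile ω₂ lam β γ T (n + 1) s t τ)) + γ ^ 2 * t * bathKinRem ω₂ lam β γ T (n + 1) τ ≤
      bathTailLate ω₂ lam β γ T (n + 1) s t := by
  rw [bathTailLate_eq_horizon hω hl hβ hγ hT n hs ht htτ hsτ, horizonReturnProfile_succ]
  have hUm := stronglyMeasurable_horizonCumFcast (T := T) hω hl hβ hγ n s t τ
  have hθU := (horizonCumFcast_sq_facts hω hl hβ hγ hT n s t τ).2
  have h := integral_kinObs_mul_ge_neg_thermalCrossDefect hω hl.le hβ.le hT hUm.measurable hθU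
  have h' := mul_le_mul_of_nonneg_left h (sq_nonneg γ)
  rw [mul_neg] at h'
  linarith

/-- The horizon return curve is square-integrable with the FREE budget: `∫ (𝔊^{s,t;τ}_N)² dν_T ≤ (|t|+4|s|)²·τ²·∫(k²−T)² dν_T` (`τ ≥ 0`). [this cell] -/
theorem horizonReturnProfile_sq_le (n : ℕ) (s t : ℝ) {τ : ℝ} (hτ : 0 ≤ τ) :
    Integrable (fun k => horizonReturnProfile ω₂ lam β γ T (n + 1) s t τ k ^ 2) (gaussianReal 0 T.toNNReal) ∧
      ∫ k, horizonReturnProfile ω₂ lam β γ T (n + 1) s t τ k ^ 2 ∂(gaussianReal 0 T.toNNReal) ≤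
        (|t| + 4 * |s|) ^ 2 * τ ^ 2 * ∫ k, (k ^ 2 - T) ^ 2 ∂(gaussianReal 0 T.toNNReal) := by
  rw [horizonReturnProfile_succ]
  have hUm := stronglyMeasurable_horizonCumFcast (T := T) hω hl hβ hγ n s t τ
  have hU2 := (horizonCumFcast_sq_facts hω hl hβ hγ hT n s t τ).1
  obtain ⟨hI, hle⟩ := integral_kickAvg_sq_le hω hl hβ hT hUm.measurable hU2
  exact ⟨hI, hle.trans (integral_horizonCumFcast_sq_le hω hl hβ hγ hT n s t hτ)⟩

end HorizonSplit


/-! ## §5 The graded pieces `(HZᶠ_{q,g})`, `(HM_{a,q,δ})`, the free rung, and ★★★ THE DOOR -/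

section Pieces

/-- **(HZᶠ_{q,g}) HORIZON-REMAINDER FLOOR at horizon exponent `q : ℕ` and grade `g`** — `UNDECIDED · INSTRUMENTABLE · IDEA-NEEDED`
(phonon-TRUE: `K_N ≥ 0`). For all parameters, eventually in `N`,
`−C·N^g ≤ γ²·N²·∫_{(N^q, ∞)} K_N(r) dr`:
the boundary kinetic-energy autocorrelation kernel has no negative mass of size `≫ N^{g−2}/γ²` BEYOND THE POLYNOMIAL HORIZON `N^q`. This scalar
is the ONLY infinite-time content of NODE 112 (door grade `g = 1`; FREE at `g = q + 2`, `horizonRemainderFloor_free`). It asks for mixing of ONE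
boundary autocorrelation past a polynomial time — no spectral gap, no rate: `|∫_{N^q}^∞ K_N| ≤ C/(γ²N)` would do, and so would positivity of the far
tail. WHY STRICTLY WEAKER than the target: it says nothing about lags `r ≤ N^q`, where the whole Ohmic `−c·N` lives (MustFail probe).
[route statement · this cell; NOT a literature fact] -/
def HorizonRemainderFloor (q : ℕ) (g : ℝ) : Prop :=
  ∀ ω₂ lam β γ : ℝ, 0 < ω₂ → 0 < lam → 0 < β → 0 < γ → ∀ T : ℝ, 0 < T →
    ∃ C : ℝ, ∃ N₀ : ℕ, ∀ N : ℕ, N₀ ≤ N →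
      -(C * (N : ℝ) ^ g) ≤ γ ^ 2 * (N : ℝ) ^ 2 * bathKinRem ω₂ lam β γ T N ((N : ℝ) ^ q)

/-- **(HM_{a,q,δ}) CONFINED MONOTONICITY OF THE HORIZON HEAT-RETURN CURVE** — `UNDECIDED · INSTRUMENTABLE · IDEA-NEEDED` (phonon-TRUE: exact
parabola). For all parameters and `c > 0`, eventually in `N`, the finite-horizon heat-return curve `k ↦ 𝔊^{aN, cN²; N^q}_N(k)` agrees `ν_T`-a.e.
with a function that is NONDECREASING IN `k²` ON THE CONFINED THERMAL RANGE `k² ≤ T·N^δ` ONLY (any fixed `δ > 0`; nothing is asked at harder kicks):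
"within the horizon, a boundary particle kicked harder — but at most `N^{δ/2}` thermal widths — returns more late-weighted heat to the bath".
WHY WEAKER than NODE 111's `(HR↑_a)` (`LateHeatReturnMonotone a`, monotone at ALL kicks, infinite horizon): the hard-kick regime `k² > T·N^δ` (where the anharmonic pinning decouples the boundary particle and
monotonicity may saturate or fail) is CUT OFF by the confinement lemma, and the horizon is finite. Not known to be comparable with the target;
not implied by any tree theorem at `lam, β > 0`. [route statement · this cell; NOT a literature fact] -/
def HorizonReturnMonotoneOn (a : ℝ) (q : ℕ) (δ : ℝ) : Prop :=
  ∀ ω₂ lam β γ : ℝ, 0 < ω₂ → 0 < lam → 0 < β → 0 < γ → ∀ T : ℝ, 0 < T → ∀ c : ℝ, 0 < c →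
    ∃ N₀ : ℕ, ∀ N : ℕ, N₀ ≤ N → ∃ R : ℝ → ℝ,
      (∀ k₁ k₂ : ℝ, k₁ ^ 2 ≤ k₂ ^ 2 → k₂ ^ 2 ≤ T * (N : ℝ) ^ δ → R k₁ ≤ R k₂) ∧
      horizonReturnProfile ω₂ lam β γ T N (a * (N : ℝ)) (c * (N : ℝ) ^ 2) ((N : ℝ) ^ q) =ᵐ[gaussianReal 0 T.toNNReal] R

/-- Grade monotonicity of `(HZᶠ)`: a floor at grade `g` is a floor at every `g' ≥ g`. [formal bookkeeping] -/
theorem HorizonRemainderFloor.mono {q : ℕ} {g g' : ℝ} (hgg' : g ≤ g') (h : HorizonRemainderFloor q g) : HorizonRemainderFloor q g' := by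
  intro ω₂ lam β γ hω hl hβ hγ T hT
  obtain ⟨C, N₀, hC⟩ := h ω₂ lam β γ hω hl hβ hγ T hT
  refine ⟨max C 0, max N₀ 1, fun N hN => ?_⟩
  have hN1 : (1 : ℝ) ≤ (N : ℝ) := by exact_mod_cast le_trans (le_max_right _ _) hN
  have h1 := hC N (le_trans (le_max_left _ _) hN)
  have h2 : C * (N : ℝ) ^ g ≤ max C 0 * (N : ℝ) ^ g' :=
    calc C * (N : ℝ) ^ g ≤ max C 0 * (N : ℝ) ^ g := mul_le_mul_of_nonneg_right (le_max_left _ _) (Real.rpow_nonneg (by linarith) _)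
      _ ≤ max C 0 * (N : ℝ) ^ g' := mul_le_mul_of_nonneg_left (Real.rpow_le_rpow_of_exponent_le hN1 hgg') (le_max_right _ _)
  linarith

variable {ω₂ lam β γ T : ℝ}

/-- `∫_{(0,∞)} K_N ≥ 0` — the escape deficit is `≤ 1` (`SubdiffusiveBondHeat.escapeDeficit_le_one`). [tree fact, repackaged] -/
theorem setIntegral_bathKinCorr_Ioi_nonneg (hω : 0 < ω₂) (hl : 0 < lam) (hβ : 0 < β) (hγ : 0 < γ) (hT : 0 < T) (N : ℕ) :
    0 ≤ ∫ u in Ioi (0 : ℝ), bathKinCorr ω₂ lam β γ T N u := by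
  have h := SubdiffusiveBondHeat.escapeDeficit_le_one ω₂ lam β γ hω hl hβ hγ T hT N
  change SubdiffusiveBondHeat.EscapeGrading.escapeDeficit ω₂ lam β γ T N ≤ 1 at h
  rw [escapeDeficit_eq_bathKinCorr] at h
  have hpos : 0 < γ / T ^ 2 := by positivity
  have h1 : 0 ≤ γ / T ^ 2 * ∫ u in Ioi (0 : ℝ), bathKinCorr ω₂ lam β γ T N u := by linarith
  exact (mul_nonneg_iff_of_pos_left hpos).1 h1

/-- **Horizon remainder lower bound** `Rem_N(τ) ≥ −2T²·τ` (`τ ≥ 0`, `N ≥ 1`): `∫_{(0,∞)} K ≥ 0` and `|K| ≤ 2T²` on `(0, τ]`. [this cell, cheap] -/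
theorem bathKinRem_ge (hω : 0 < ω₂) (hl : 0 < lam) (hβ : 0 < β) (hγ : 0 < γ) (hT : 0 < T) {N : ℕ} (hN : 0 < N) {τ : ℝ} (hτ : 0 ≤ τ) :
    -(2 * T ^ 2 * τ) ≤ bathKinRem ω₂ lam β γ T N τ := by
  obtain ⟨-, hKb, hKI⟩ := bathKinCorr_basics hω hl hβ hγ hT hN
  have hsplit : ∫ u in Ioi (0 : ℝ), bathKinCorr ω₂ lam β γ T N u =
      (∫ u in Ioc (0 : ℝ) τ, bathKinCorr ω₂ lam β γ T N u) + bathKinRem ω₂ lam β γ T N τ := by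
    unfold bathKinRem
    rw [← setIntegral_union (Set.Ioc_disjoint_Ioi le_rfl) measurableSet_Ioi (hKI.mono_set Ioc_subset_Ioi_self)
      (hKI.mono_set (Ioi_subset_Ioi hτ)), Ioc_union_Ioi_eq_Ioi hτ]
  have hfin : ‖∫ u in Ioc (0 : ℝ) τ, bathKinCorr ω₂ lam β γ T N u‖ ≤ 2 * T ^ 2 * volume.real (Ioc (0 : ℝ) τ) :=
    norm_setIntegral_le_of_norm_le_const measure_Ioc_lt_top fun u _ => by rw [Real.norm_eq_abs]; exact hKb u
  rw [Real.volume_real_Ioc_of_le hτ, sub_zero, Real.norm_eq_abs] at hfin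
  have h0 := setIntegral_bathKinCorr_Ioi_nonneg hω hl hβ hγ hT N
  have h3 := (abs_le.1 hfin).2
  linarith

/-- ★ **THE FREE RUNG `(HZᶠ_{q, q+2})`**: `γ²N²·Rem_N(N^q) ≥ −2γ²T²·N^{q+2}` — unconditional. The open content of `(HZᶠ_{q,g})` is exactly the
exponent range `g < q + 2` (door: `g = 1`). [this cell] -/
theorem horizonRemainderFloor_free (q : ℕ) : HorizonRemainderFloor q ((q : ℝ) + 2) := by
  intro ω₂ lam β γ hω hl hβ hγ T hT
  refine ⟨2 * γ ^ 2 * T ^ 2, 1, fun N hN => ?_⟩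
  have hNpos : 0 < N := Nat.lt_of_lt_of_le Nat.zero_lt_one hN
  have hNr : (0 : ℝ) ≤ (N : ℝ) := Nat.cast_nonneg N
  have h := bathKinRem_ge hω hl hβ hγ hT hNpos (τ := (N : ℝ) ^ q) (pow_nonneg hNr q)
  have e : (N : ℝ) ^ ((q : ℝ) + 2) = (N : ℝ) ^ q * (N : ℝ) ^ 2 := by
    rw [show (q : ℝ) + 2 = ((q + 2 : ℕ) : ℝ) by push_cast; ring, Real.rpow_natCast, pow_add]
  rw [e]
  have h2 := mul_le_mul_of_nonneg_left h (mul_nonneg (sq_nonneg γ) (sq_nonneg (N : ℝ)))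
  calc -(2 * γ ^ 2 * T ^ 2 * ((N : ℝ) ^ q * (N : ℝ) ^ 2)) = γ ^ 2 * (N : ℝ) ^ 2 * -(2 * T ^ 2 * (N : ℝ) ^ q) := by ring
    _ ≤ γ ^ 2 * (N : ℝ) ^ 2 * bathKinRem ω₂ lam β γ T N ((N : ℝ) ^ q) := h2

/-- Eventually in `N`, `c ≤ N^ε` (`ε > 0`). [formal bookkeeping] -/
theorem exists_nat_forall_le_natCast_rpow {ε : ℝ} (hε : 0 < ε) (c : ℝ) : ∃ N₀ : ℕ, ∀ N : ℕ, N₀ ≤ N → c ≤ (N : ℝ) ^ ε := by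
  have h := ((tendsto_rpow_atTop hε).comp tendsto_natCast_atTop_atTop).eventually_ge_atTop c
  obtain ⟨N₀, hN₀⟩ := eventually_atTop.1 h
  exact ⟨N₀, fun N hN => hN₀ N hN⟩

/-- The kick average of a measurable function is strongly measurable. [folklore] -/
theorem stronglyMeasurable_kickAvg (hω : 0 < ω₂) (hl' : 0 ≤ lam) (hβ' : 0 ≤ β) (γ : ℝ) (hT : 0 < T) (n : ℕ)
    {F : PhaseSpace (n + 1) → ℝ} (hF : Measurable F) : StronglyMeasurable (kickAvg ω₂ lam β γ T n F) := by
  haveI := pinnedChain_isProbabilityMeasure_gibbsMeasure hω hl' hβ' γ (n + 1) hT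
  have h1 : StronglyMeasurable (fun x : ℝ × PhaseSpace (n + 1) => F (x.2.1, Function.update x.2.2 0 x.1)) :=
    (hF.comp (measurable_setMomentum n)).stronglyMeasurable
  exact StronglyMeasurable.integral_prod_right' (ν := (pinnedChain ω₂ lam β γ).gibbsMeasure (n + 1) T) h1

/-- **Pure-real packaging of the confinement step**: if `g ∈ L²(ν_T)` agrees a.e. with a function nondecreasing in `k²` on `k² ≤ T·X`
(`X ≥ 4`), `∫g² ≤ B·P` with `1 ≤ P ≤ X^j`, then `𝔇_T(g) ≤ A_{T,j}·T^{-j}·(1 + B)` — the polynomial budget `P` is beaten by the confinement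
gain `X^{-j}`. [this cell] -/
theorem thermalCrossDefect_le_of_confined (hT : 0 < T) {j : ℕ} {A : ℝ} (hA0 : 0 ≤ A)
    (hA : ∀ (κ : ℝ) (g : ℝ → ℝ), 4 * T ≤ κ ^ 2 → AEStronglyMeasurable g (gaussianReal 0 T.toNNReal) →
      Integrable (fun k => g k ^ 2) (gaussianReal 0 T.toNNReal) →
      (∀ k₁ k₂ : ℝ, k₁ ^ 2 ≤ k₂ ^ 2 → k₂ ^ 2 ≤ κ ^ 2 → g k₁ ≤ g k₂) →
      thermalCrossDefect T g ≤ A * (κ ^ 2)⁻¹ ^ j * (1 + ∫ k, g k ^ 2 ∂(gaussianReal 0 T.toNNReal)))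
    {g R : ℝ → ℝ} {X B P : ℝ} (hX : 4 ≤ X) (hgm : AEStronglyMeasurable g (gaussianReal 0 T.toNNReal))
    (hg2 : Integrable (fun k => g k ^ 2) (gaussianReal 0 T.toNNReal))
    (hgB : ∫ k, g k ^ 2 ∂(gaussianReal 0 T.toNNReal) ≤ B * P) (hB : 0 ≤ B) (hP1 : 1 ≤ P) (hPX : P ≤ X ^ j)
    (hRmono : ∀ k₁ k₂ : ℝ, k₁ ^ 2 ≤ k₂ ^ 2 → k₂ ^ 2 ≤ T * X → R k₁ ≤ R k₂) (hRae : g =ᵐ[gaussianReal 0 T.toNNReal] R) :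
    thermalCrossDefect T g ≤ A * T⁻¹ ^ j * (1 + B) := by
  have hX0 : 0 < X := by linarith
  rw [thermalCrossDefect_congr_ae hRae]
  have hRm : AEStronglyMeasurable R (gaussianReal 0 T.toNNReal) := hgm.congr hRae
  have hR2ae : (fun k => g k ^ 2) =ᵐ[gaussianReal 0 T.toNNReal] fun k => R k ^ 2 := by
    filter_upwards [hRae] with k hk
    rw [hk]
  have hR2 : Integrable (fun k => R k ^ 2) (gaussianReal 0 T.toNNReal) := hg2.congr hR2ae
  have hR2le : ∫ k, R k ^ 2 ∂(gaussianReal 0 T.toNNReal) ≤ B * P := by rw [← integral_congr_ae hR2ae]; exact hgB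
  have hTX : 0 ≤ T * X := mul_nonneg hT.le hX0.le
  have hκ : 4 * T ≤ Real.sqrt (T * X) ^ 2 := by
    rw [Real.sq_sqrt hTX]
    calc 4 * T = T * 4 := mul_comm _ _
      _ ≤ T * X := mul_le_mul_of_nonneg_left hX hT.le
  have hmono' : ∀ k₁ k₂ : ℝ, k₁ ^ 2 ≤ k₂ ^ 2 → k₂ ^ 2 ≤ Real.sqrt (T * X) ^ 2 → R k₁ ≤ R k₂ := by
    intro k₁ k₂ h12 h2
    rw [Real.sq_sqrt hTX] at h2
    exact hRmono k₁ k₂ h12 h2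
  have hconf := hA (Real.sqrt (T * X)) R hκ hRm hR2 hmono'
  rw [Real.sq_sqrt hTX] at hconf
  have h1 : 1 + ∫ k, R k ^ 2 ∂(gaussianReal 0 T.toNNReal) ≤ (1 + B) * P := by nlinarith
  have hinvj : 0 ≤ (T * X)⁻¹ ^ j := pow_nonneg (inv_nonneg.2 hTX) j
  have hXj : 0 < X ^ j := pow_pos hX0 j
  calc thermalCrossDefect T R ≤ A * (T * X)⁻¹ ^ j * (1 + ∫ k, R k ^ 2 ∂(gaussianReal 0 T.toNNReal)) := hconf
    _ ≤ A * (T * X)⁻¹ ^ j * ((1 + B) * P) := mul_le_mul_of_nonneg_left h1 (mul_nonneg hA0 hinvj)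
    _ = A * T⁻¹ ^ j * (1 + B) * (P * (X ^ j)⁻¹) := by rw [mul_inv, mul_pow, inv_pow]; ring
    _ ≤ A * T⁻¹ ^ j * (1 + B) * 1 := by
        refine mul_le_mul_of_nonneg_left ?_ (by positivity)
        rwa [mul_inv_le_iff₀ hXj, one_mul]
    _ = A * T⁻¹ ^ j * (1 + B) := mul_one _

/-- **The free budget at the door's scales** (`N ≥ 1`, `0 ≤ a`, `0 < c`): `∫ (𝔊^{aN,cN²;N^q}_N)² dν_T ≤ (c+4a)²·(∫(k²−T)²dν_T)·N^{2q+4}`.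
[this cell] -/
theorem horizonReturnProfile_sq_le_poly (hω : 0 < ω₂) (hl : 0 < lam) (hβ : 0 < β) (hγ : 0 < γ) (hT : 0 < T) (n : ℕ) {a c Nr : ℝ}
    (ha : 0 ≤ a) (hc : 0 < c) (hNr1 : 1 ≤ Nr) (q : ℕ) :
    Integrable (fun k => horizonReturnProfile ω₂ lam β γ T (n + 1) (a * Nr) (c * Nr ^ 2) (Nr ^ q) k ^ 2) (gaussianReal 0 T.toNNReal) ∧
    ∫ k, horizonReturnProfile ω₂ lam β γ T (n + 1) (a * Nr) (c * Nr ^ 2) (Nr ^ q) k ^ 2 ∂(gaussianReal 0 T.toNNReal) ≤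
      ((c + 4 * a) ^ 2 * ∫ k, (k ^ 2 - T) ^ 2 ∂(gaussianReal 0 T.toNNReal)) * Nr ^ (2 * q + 4) := by
  have hNr0 : 0 ≤ Nr := by linarith
  obtain ⟨K0, hK0⟩ : ∃ x : ℝ, x = ∫ k, (k ^ 2 - T) ^ 2 ∂(gaussianReal 0 T.toNNReal) := ⟨_, rfl⟩
  have hK00 : 0 ≤ K0 := by rw [hK0]; exact integral_nonneg fun k => sq_nonneg _
  obtain ⟨hI, hle⟩ := horizonReturnProfile_sq_le hω hl hβ hγ hT n (a * Nr) (c * Nr ^ 2) (pow_nonneg hNr0 q)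
  rw [← hK0] at hle ⊢
  refine ⟨hI, hle.trans ?_⟩
  have hs : 0 ≤ a * Nr := mul_nonneg ha hNr0
  have ht : 0 ≤ c * Nr ^ 2 := by positivity
  have hW : |c * Nr ^ 2| + 4 * |a * Nr| ≤ (c + 4 * a) * Nr ^ 2 := by
    rw [abs_of_nonneg ht, abs_of_nonneg hs]
    nlinarith
  have hW0 : 0 ≤ |c * Nr ^ 2| + 4 * |a * Nr| := by positivity
  calc (|c * Nr ^ 2| + 4 * |a * Nr|) ^ 2 * (Nr ^ q) ^ 2 * K0 ≤ ((c + 4 * a) * Nr ^ 2) ^ 2 * (Nr ^ q) ^ 2 * K0 := by gcongr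
    _ = (c + 4 * a) ^ 2 * K0 * Nr ^ (2 * q + 4) := by ring

/-- ★★★ **THE DOOR OF NODE 112** (`0 ≤ a`, `3 ≤ q`, `0 < δ`): the horizon-remainder floor at grade `1` and confined monotonicity of the horizon
heat-return curve imply the late bath-tail floor at the `N`-linear window, grade `1`:
`(HZᶠ_{q,1}) ∧ (HM_{a,q,δ}) ⟹ LateTailFloor a 1 1`.
Proof = horizon split + free `L²` budget `O(N^{2q+4})` + CONFINEMENT LEMMA with `κ² = T·N^δ` and `j ≥ (2q+4)/δ` (defect `O(1)`) + the remainder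
piece. No spectral gap, no corrector budget, no Harris constant enters a bound. [this cell] -/
theorem lateTailFloor_one_of_horizon {a δ : ℝ} {q : ℕ} (ha : 0 ≤ a) (hq : 3 ≤ q) (hδ : 0 < δ)
    (hZ : HorizonRemainderFloor q 1) (hM : HorizonReturnMonotoneOn a q δ) : LateTailFloor a 1 1 := by
  intro ω₂ lam β γ hω hl hβ hγ T hT c hc
  obtain ⟨C₁, N₁, hC₁⟩ := hZ ω₂ lam β γ hω hl hβ hγ T hT
  obtain ⟨N₂, hN₂⟩ := hM ω₂ lam β γ hω hl hβ hγ T hT c hc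
  obtain ⟨j, hj⟩ := exists_nat_ge ((2 * (q : ℝ) + 4) / δ)
  have hjδ : 2 * (q : ℝ) + 4 ≤ δ * (j : ℝ) := by
    rw [div_le_iff₀ hδ] at hj
    linarith [mul_comm (j : ℝ) δ]
  obtain ⟨A, hA0, hA⟩ := thermalCrossDefect_le_of_monotoneSqOn hT j
  obtain ⟨N₃, hN₃⟩ := exists_nat_forall_le_natCast_rpow hδ 4
  obtain ⟨N₄, hN₄⟩ := exists_nat_ge (max c (2 * a))
  obtain ⟨B, hB⟩ : ∃ x : ℝ, x = (c + 4 * a) ^ 2 * ∫ k, (k ^ 2 - T) ^ 2 ∂(gaussianReal 0 T.toNNReal) := ⟨_, rfl⟩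
  have hB0 : 0 ≤ B := by rw [hB]; exact mul_nonneg (sq_nonneg _) (integral_nonneg fun k => sq_nonneg _)
  obtain ⟨C₂, hC₂⟩ : ∃ x : ℝ, x = γ ^ 2 * (A * T⁻¹ ^ j * (1 + B)) := ⟨_, rfl⟩
  have hC₂0 : 0 ≤ C₂ := by rw [hC₂]; positivity
  refine ⟨c * C₁ + C₂, max (max N₁ N₂) (max (max N₃ N₄) 1), fun N hN => ?_⟩
  have hNN₁ : N₁ ≤ N := le_trans (le_trans (le_max_left _ _) (le_max_left _ _)) hN
  have hNN₂ : N₂ ≤ N := le_trans (le_trans (le_max_right _ _) (le_max_left _ _)) hN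
  have hNN₃ : N₃ ≤ N := le_trans (le_trans (le_trans (le_max_left _ _) (le_max_left _ _)) (le_max_right _ _)) hN
  have hNN₄ : N₄ ≤ N := le_trans (le_trans (le_trans (le_max_right _ _) (le_max_left _ _)) (le_max_right _ _)) hN
  have hN1 : 1 ≤ N := le_trans (le_trans (le_max_right _ _) (le_max_right _ _)) hN
  obtain ⟨n, rfl⟩ : ∃ n, N = n + 1 := ⟨N - 1, by omega⟩
  -- instantiate the pieces at `N = n+1`, then make `(N : ℝ)` opaque
  have hZ1 := hC₁ (n + 1) hNN₁
  obtain ⟨R, hRmono, hRae⟩ := hN₂ (n + 1) hNN₂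
  have h4 := hN₃ (n + 1) hNN₃
  obtain ⟨Nr, hNr⟩ : ∃ x : ℝ, x = ((n + 1 : ℕ) : ℝ) := ⟨_, rfl⟩
  rw [← hNr, Real.rpow_one] at hZ1
  rw [← hNr] at hRmono hRae h4
  rw [← hNr]
  have hNr1 : (1 : ℝ) ≤ Nr := by rw [hNr]; exact_mod_cast hN1
  have hNr0 : (0 : ℝ) < Nr := by linarith
  have hN4r : ((N₄ : ℕ) : ℝ) ≤ Nr := by rw [hNr]; exact_mod_cast hNN₄
  have hcN : c ≤ Nr := le_trans (le_trans (le_max_left _ _) hN₄) hN4r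
  have haN : 2 * a ≤ Nr := le_trans (le_trans (le_max_right _ _) hN₄) hN4r
  -- the scales
  have hs : 0 ≤ a * Nr := mul_nonneg ha hNr0.le
  have ht : 0 ≤ c * Nr ^ 2 := by positivity
  have hq3 : Nr ^ 3 ≤ Nr ^ q := pow_le_pow_right₀ hNr1 hq
  have hNr3 : Nr ^ 3 = Nr * Nr ^ 2 := by ring
  have htτ : c * Nr ^ 2 ≤ Nr ^ q := le_trans (by rw [hNr3]; exact mul_le_mul_of_nonneg_right hcN (sq_nonneg _)) hq3
  have hsτ : 2 * (a * Nr) ≤ Nr ^ q := by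
    refine le_trans ?_ hq3
    rw [hNr3]
    calc 2 * (a * Nr) = (2 * a) * Nr := by ring
      _ ≤ Nr * Nr := mul_le_mul_of_nonneg_right haN hNr0.le
      _ ≤ Nr * Nr ^ 2 := mul_le_mul_of_nonneg_left (by nlinarith) hNr0.le
  -- the pointwise door at horizon `N^q`
  have hdoor := bathTailLate_ge_horizon hω hl hβ hγ hT n hs ht htτ hsτ
  -- the remainder piece
  have hrem : -(c * C₁ * Nr) ≤ γ ^ 2 * (c * Nr ^ 2) * bathKinRem ω₂ lam β γ T (n + 1) (Nr ^ q) := by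
    have h' := mul_le_mul_of_nonneg_left hZ1 hc.le
    calc -(c * C₁ * Nr) = c * -(C₁ * Nr) := by ring
      _ ≤ c * (γ ^ 2 * Nr ^ 2 * bathKinRem ω₂ lam β γ T (n + 1) (Nr ^ q)) := h'
      _ = _ := by ring
  -- the defect via the free budget and confinement
  have hdef : γ ^ 2 * thermalCrossDefect T (horizonReturnProfile ω₂ lam β γ T (n + 1) (a * Nr) (c * Nr ^ 2) (Nr ^ q)) ≤ C₂ * Nr := by
    obtain ⟨h𝔊2, h𝔊le⟩ := horizonReturnProfile_sq_le_poly hω hl hβ hγ hT n ha hc hNr1 q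
    rw [← hB] at h𝔊le
    have h𝔊m : AEStronglyMeasurable (horizonReturnProfile ω₂ lam β γ T (n + 1) (a * Nr) (c * Nr ^ 2) (Nr ^ q))
        (gaussianReal 0 T.toNNReal) := by
      rw [horizonReturnProfile_succ]
      exact (stronglyMeasurable_kickAvg hω hl.le hβ.le γ hT n
        (stronglyMeasurable_horizonCumFcast (T := T) hω hl hβ hγ n _ _ _).measurable).aestronglyMeasurable
    have hP1 : (1 : ℝ) ≤ Nr ^ (2 * q + 4) := one_le_pow₀ hNr1
    have hPX : Nr ^ (2 * q + 4) ≤ (Nr ^ δ) ^ j := by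
      rw [← Real.rpow_natCast Nr (2 * q + 4), ← Real.rpow_natCast (Nr ^ δ) j, ← Real.rpow_mul hNr0.le]
      exact Real.rpow_le_rpow_of_exponent_le hNr1 (by push_cast; linarith)
    have h := thermalCrossDefect_le_of_confined hT hA0 hA h4 h𝔊m h𝔊2 h𝔊le hB0 hP1 hPX hRmono hRae
    calc _ ≤ γ ^ 2 * (A * T⁻¹ ^ j * (1 + B)) := mul_le_mul_of_nonneg_left h (sq_nonneg γ)
      _ = C₂ * 1 := by rw [hC₂, mul_one]
      _ ≤ C₂ * Nr := mul_le_mul_of_nonneg_left hNr1 hC₂0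
  -- assemble
  rw [Real.rpow_one]
  linarith

/-- ★ **NODE 112 lands on the blocker**: `(S) ∧ (HZᶠ_{q,1}) ∧ (HM_{a,q,δ}) ⟹ BoundedResponse` (stmt-11071), `0 ≤ a`, `3 ≤ q`, `0 < δ`. [this cell] -/
theorem boundedResponse_of_subdiffusiveBondHeat_horizon {a δ : ℝ} {q : ℕ} (ha : 0 ≤ a) (hq : 3 ≤ q) (hδ : 0 < δ)
    (hS : Theses.BondHeatUncertainty.SubdiffusiveBondHeat) (hZ : HorizonRemainderFloor q 1) (hM : HorizonReturnMonotoneOn a q δ) :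
    Theses.BondHeatUncertainty.BoundedResponse :=
  boundedResponse_of_subdiffusiveBondHeat_lateTailFloor ha le_rfl hS (lateTailFloor_one_of_horizon ha hq hδ hZ hM)

end Pieces

end Summit.AtomisticToContinuum.FouriersLaw.Theorems.BoundedResponse.HeatSpreading

end
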